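import Literature.Computability.AlgebraicComplexity.OrbitClosureWeightDegenerations
import Literature.LinearAlgebra.Matrix.SkewDetEvenCycles
import HarnessLib

/-!
# GCT I §4.2, the Tutte-matrix example: `D(Y) = t^{2W} h(Y) + …`, `h(Y)` = the pairs of
# minimum-weight perfect matchings, and `h(Y) ∈ Δ[det(Y)]` — PROOF

Topic `Computability/AlgebraicComplexity`. Cell `val-lit`, row MS2001-A (K. Mulmuley, M. Sohoni,
*Geometric complexity theory I*, SIAM J. Comput. 31 (2001) 496–526), §4.2, typed from the
AUTHORS' VERSION (AV; text of record `HOME/bip/texts/MS2001-authorversion/`, locators «AV p.N,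
all.txt Lnnnn»). Completes the §4.2 example begun in
`Literature/LinearAlgebra/Matrix/SkewDetEvenCycles.lean` (eq. (6)) and
`MS2001DetInitialForms.lean` (the `lim_{t→0}` device for the determinant with arbitrary entry
weights): typed and proved here is the TUTTE SPECIALISATION itself — the skew-symmetric Tutte
matrix of a weighted graph, the exponent `2W`, and the identification of `h(Y)` with the pairs of
minimum-weight perfect matchings. Theorems and bodied definitions only: no named facts, no
instances, no `sorry`.

## The source (AV pp.17–18, all.txt L1184–1252)

> "Let `G` be a nonbipartite graph on `m` vertices whose edges have nonnegative integer weights.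
> Consider its skew-symmetric Tutte matrix `M` whose `(i, j)`-th entry `M_{ij}`, `i < j`, is the
> variable `y_{ij}` if `G` has an edge joining vertices `i` and `j`, and zero otherwise. We have
> `det(M) = ∑_σ sign(σ) wt(σ)`, where `σ` ranges over all permutations of `[1, …, m]`, and `wt(σ)`
> is the product of the entries `M_{iσ(i)}`. Define the cycle graph of `σ` with nonzero weight to
> be the subgraph of `G` formed by the edges `(i, σ(i))`. Then it is known and easy to see that
> `det(M) = ∑_{σ'} sign(σ') wt(σ')` (6), where `σ'` ranges over only those permutations with nonzero
> weight whose cycle graphs contain only cycles of even length […]. Construct a modified Tutte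
> matrix `M̃` by replacing every variable `y_{ij}`, if it indeed occurs in `M`, by `t^{w_{ij}} y_{ij}`
> […]. Then eq.(6) implies that `D(Y) = det(M̃) = t^{2W} h(Y) +` higher order terms in `t`, where
> `W` is the weight of a minimum-weight perfect matching in `G` and `h(Y) = ∑_σ sign(σ) wt(σ)`,
> where `σ` ranges over all permutations with nonzero weight whose cycle graphs can be decomposed
> as the union of two minimum-weight perfect matchings, not necessarily distinct. Clearly
> `D(Y) = det(M̃)` belongs to the projective orbit closure `Δ[det(Y)]` for every `t`. […] In other
> words, `h(Y)` belongs to the projective closure `Δ[det(Y)]`."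

## Contents

§1 (private) 2-colourings of even-cycle permutations along the permutation (positions along a
cycle via `IsCycle.zpowersEquivSupport`). §2 the weighted graph: `MS2001Tutte.IsOnGraph`
(permutations of nonzero weight), `edges` (the cycle graph / a matching as an edge set),
`IsPerfectMatching` (perfect matchings, encoded by involutions — faithful:
`IsPerfectMatching.exists_subgraph`, `exists_isPerfectMatching_of_subgraph` against Mathlib's
`SimpleGraph.Subgraph.IsPerfectMatching`), `matchingWeight`, `minMatchingWeight` (`W`),
`IsMinPerfectMatching`, `IsUnionOfTwoMinMatchings`, `texp` (the exponent `∑_i w_{iσ(i)}` of `t`),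
`evenPerms` (the index set of eq. (6)), `hPerms` (the index set of `h(Y)`), and the combinatorial
heart:
* **`two_mul_minMatchingWeight_le_texp`** — `∑_i w_{iσ(i)} ≥ 2W` for every `σ` of eq. (6) (an
  alternating colouring splits the even cycle graph into two perfect matchings `τ₁, τ₂` with
  `weight(τ₁) + weight(τ₂) = ∑_i w_{iσ(i)}`);
* **`texp_eq_two_mul_minMatchingWeight_iff`** — equality holds iff the cycle graph of `σ` is the
  union of two minimum-weight perfect matchings (not necessarily distinct); converse direction: if
  the cycle graph is `τ₁ ∪ τ₂` then `{τ₁(x), τ₂(x)} = {σ(x), σ⁻¹(x)}` at every vertex;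
* `hPerms_subset_evenPerms` — such `σ` automatically have even cycle graphs (`τ₁` restricts to a
  fixed-point-free involution of each cycle), `exists_isMinPerfectMatching_of_mem_evenPerms`
  (`W` is attained).
§3 the Tutte matrix `MS2001Tutte.tutteMatrix` over the coordinate ring of the `m × m` variable
matrix `Y` (`y_{ij} = x_{(i,j)}`, `i < j`), the modified matrix `tutteMatrixScaled` (`= α(t) M`),
the Leibniz terms `permTerm σ = sign(σ) wt(σ)`, `tutteInitialForm = h(Y)`, and
* `det_tutteMatrixScaled_eq_sum` / `det_tutteMatrix_eq_sum` — eq. (6) for `M̃` and `M`: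
  `det(M̃) = ∑_{σ ∈ evenPerms} t^{texp σ} sign(σ) wt(σ)` (from the tree's
  `det_eq_sum_filter_cycleType_even_of_alternating`, applied to `M̃ᵀ` so that `wt(σ) =
  ∏_i M_{iσ(i)}` as printed);
* `det_tutteMatrixScaled_mem_endOrbit` — "clearly `D(Y) ∈ Δ[det(Y)]` for every `t`"
  (`det(M̃) ∈ End · det(Y)`).
§4 the two displayed claims:
* **`MS2001_sec_4_2_tutte_det_expansion`** — `D(Y) = t^{2W} h(Y) + ∑_{σ ∈ evenPerms, texp σ > 2W}
  t^{texp σ} sign(σ) wt(σ)`;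
* `MS2001_sec_4_2_tutteInitialForm_eq_weightedHomogeneousComponent` — `h(Y)` is the weight-`2W`
  component of `det(M)` for the weight `y_{ij} ↦ w_{ij}`;
* **`MS2001_sec_4_2_tutteInitialForm_mem_orbitClosure`** — `h(Y) ∈ Δ[det(Y)]` over every infinite
  field (tree: `weightedHomogeneousComponent_mem_orbitClosure`, the §4.2 `lim_{t→0}` device, and
  `End · det ⊆ Δ[det]`).

## Rendering (disclosed)

* Vertices are `Fin m`, `G : SimpleGraph (Fin m)`, weights `w : Sym2 (Fin m) → ℕ` on unordered
  pairs (only the values on edges matter). "Nonbipartite" plays no role in the displayed claims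
  and is not assumed; a graph without perfect matching has `evenPerms = ∅`, `D(Y) = 0`, `h(Y) = 0`
  and (by convention `sInf ∅ = 0`) `W = 0`, and all statements hold trivially.
* A perfect matching is ENCODED by the involution exchanging the ends of its edges
  (`IsPerfectMatching G τ : τ(τ i) = i ∧ G.Adj i (τ i)`); §2 proves this is a faithful encoding of
  Mathlib's `Subgraph.IsPerfectMatching`. Its weight is the sum of `w` over its edge set.
* "The cycle graph of `σ` can be decomposed as the union of two minimum-weight perfect matchings,
  not necessarily distinct" is read as an equality of EDGE SETS `edges σ = edges τ₁ ∪ edges τ₂`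
  (a 2-cycle of `σ` contributes one edge, lying in both matchings).
* `Δ[det(Y)] = orbitClosure (detPoly (Fin m) k)` (affine `GL_{m²}`-orbit closure, the tree's
  reading of the projective closure, as in `MS2001DetInitialForms.lean`); `D(Y)`, `M`, `h(Y)` live
  in the same polynomial ring `k[x_{(i,j)}]`, the variable `y_{ij}` (`i < j`) being `x_{(i,j)}`.
* The unnumbered CONJECTURE closing the example ("for every `m` some weighted nonbipartite `G`
  gives an `h(Y)` without small formulas", an exterior point of `Δ[det]`) is not Literature and is
  not typed.

Honest framing: literature typing of a worked example; nothing here bears on any separation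
(`VP ≠ VNP` NOT proved).

## References

* [MulmuleySohoniSIAM2001] K. Mulmuley, M. Sohoni, *Geometric complexity theory I: an approach to
  the P vs. NP and related problems*, SIAM J. Comput. 31 (2001) 496–526, §4.2 (AV pp.17–18,
  all.txt L1184–1262).
-/

noncomputable section

open MvPolynomial Finset
open scoped Matrix

namespace Literature.Computability.AlgebraicComplexity

namespace MS2001Tutte

/-! ## §1. Even-cycle permutations are 2-colourable along the permutation -/

section Coloring

variable {α : Type*} [Fintype α] [DecidableEq α]

/-- A cycle of even length carries a colouring that alternates along the cycle. [folklore] -/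
private theorem exists_coloring_of_isCycle {C : Equiv.Perm α} (hC : C.IsCycle)
    (heven : Even C.support.card) :
    ∃ col : α → Bool, ∀ x ∈ C.support, col (C x) = !col x := by
  classical
  set ℓ := orderOf C with hℓ
  have hord : ℓ = C.support.card := hC.orderOf
  have hℓpos : 0 < ℓ := orderOf_pos C
  let E : Fin ℓ ≃ C.support :=
    (finEquivZPowers (isOfFinOrder_of_finite C)).trans hC.zpowersEquivSupport
  have hE : ∀ n : Fin ℓ, ((E n : C.support) : α) = (C ^ (n : ℕ)) (Classical.choose hC) :=
    fun n => rfl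
  -- position of a support point along the cycle
  let pos : ∀ x ∈ C.support, ℕ := fun x hx => ((E.symm ⟨x, hx⟩ : Fin ℓ) : ℕ)
  have hpos_lt : ∀ x (hx : x ∈ C.support), pos x hx < ℓ := fun x hx => (E.symm ⟨x, hx⟩).2
  have hpos_apply : ∀ x (hx : x ∈ C.support), (C ^ pos x hx) (Classical.choose hC) = x := by
    intro x hx
    have := congrArg (fun y : C.support => (y : α)) (E.apply_symm_apply ⟨x, hx⟩)
    rw [hE] at this
    exact this
  have hpos_inj : ∀ (p q : ℕ) (hp : p < ℓ) (hq : q < ℓ),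
      (C ^ p) (Classical.choose hC) = (C ^ q) (Classical.choose hC) → p = q := by
    intro p q hp hq h
    have h' : E ⟨p, hp⟩ = E ⟨q, hq⟩ := Subtype.ext (by rw [hE, hE]; exact h)
    exact congrArg Fin.val (E.injective h')
  refine ⟨fun x => if hx : x ∈ C.support then decide (Even (pos x hx)) else false, ?_⟩
  intro x hx
  have hCx : C x ∈ C.support := Equiv.Perm.apply_mem_support.mpr hx
  simp only [dif_pos hx, dif_pos hCx]
  -- `pos (C x) = (pos x + 1) % ℓ`
  have hq : pos (C x) hCx = (pos x hx + 1) % ℓ := by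
    refine hpos_inj _ _ (hpos_lt _ _) (Nat.mod_lt _ hℓpos) ?_
    rw [hpos_apply, pow_mod_orderOf, pow_succ', Equiv.Perm.mul_apply, hpos_apply]
  -- parity flips since `ℓ` is even
  have hℓeven : Even ℓ := hord ▸ heven
  have hpar : Even (pos (C x) hCx) ↔ ¬ Even (pos x hx) := by
    rw [hq]
    have hdm := Nat.mod_add_div (pos x hx + 1) ℓ
    have h1 : Even ((pos x hx + 1) % ℓ) ↔ Even (pos x hx + 1) := by
      constructor
      · intro h
        rw [← hdm]
        exact h.add (hℓeven.mul_right _)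
      · intro h
        have h2 : Even ((pos x hx + 1) % ℓ + ℓ * ((pos x hx + 1) / ℓ)) := by rwa [hdm]
        exact (Nat.even_add.mp h2).mpr (hℓeven.mul_right _)
    rw [h1, Nat.even_add_one]
  by_cases hp : Even (pos x hx)
  · have : ¬ Even (pos (C x) hCx) := fun h => (hpar.mp h) hp
    simp [hp, this]
  · have : Even (pos (C x) hCx) := hpar.mpr hp
    simp [hp, this]

/-- A permutation all of whose cycles have even length carries a colouring alternating along it
on its support. [folklore] -/
private theorem exists_coloring (σ : Equiv.Perm α) (heven : ∀ c ∈ σ.cycleType, Even c) :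
    ∃ col : α → Bool, ∀ x, σ x ≠ x → col (σ x) = !col x := by
  classical
  have hcyc : ∀ C : Equiv.Perm α, ∃ col : α → Bool, C.IsCycle → Even C.support.card →
      ∀ x ∈ C.support, col (C x) = !col x := by
    intro C
    by_cases h : C.IsCycle ∧ Even C.support.card
    · obtain ⟨col, hcol⟩ := exists_coloring_of_isCycle h.1 h.2
      exact ⟨col, fun _ _ => hcol⟩
    · exact ⟨fun _ => false, fun h1 h2 => (h ⟨h1, h2⟩).elim⟩
  choose col hcol using hcyc
  refine ⟨fun x => col (σ.cycleOf x) x, fun x hx => ?_⟩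
  have hC : (σ.cycleOf x).IsCycle := σ.isCycle_cycleOf hx
  have hmem : σ.cycleOf x ∈ σ.cycleFactorsFinset :=
    Equiv.Perm.cycleOf_mem_cycleFactorsFinset_iff.mpr (Equiv.Perm.mem_support.mpr hx)
  have hevenC : Even (σ.cycleOf x).support.card := by
    apply heven
    rw [Equiv.Perm.cycleType_def]
    exact Multiset.mem_map.mpr ⟨σ.cycleOf x, hmem, rfl⟩
  have hxC : x ∈ (σ.cycleOf x).support := by
    rw [Equiv.Perm.mem_support, Equiv.Perm.cycleOf_apply_self]; exact hx
  show col (σ.cycleOf (σ x)) (σ x) = !col (σ.cycleOf x) x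
  rw [Equiv.Perm.cycleOf_self_apply]
  have := hcol _ hC hevenC x hxC
  rwa [Equiv.Perm.cycleOf_apply_self] at this

end Coloring

/-! ## §2. The weighted graph: perfect matchings, cycle graphs, the exponent of `t` -/

section Graph

variable {m : ℕ} (G : SimpleGraph (Fin m)) (w : Sym2 (Fin m) → ℕ)

/-- The permutations of NONZERO WEIGHT in the Leibniz expansion of the Tutte matrix of `G`: every
`(i, σ(i))` is an edge of `G` ("Define the cycle graph of `σ` with nonzero weight to be the
subgraph of `G` formed by the edges `(i, σ(i))`").
[cite: MulmuleySohoniSIAM2001, §4.2 (AV p.17, all.txt L1190–1196)] -/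
def IsOnGraph (σ : Equiv.Perm (Fin m)) : Prop := ∀ i, G.Adj i (σ i)

/-- The edge set `{ {i, π(i)} : i }` of a permutation `π`: for `π` of nonzero weight this is the
CYCLE GRAPH of `π`; for a perfect matching (encoded by its involution) it is the matching itself.
[cite: MulmuleySohoniSIAM2001, §4.2 (AV p.17, all.txt L1194–1196)] -/
def edges (π : Equiv.Perm (Fin m)) : Finset (Sym2 (Fin m)) :=
  univ.image fun i => s(i, π i)

/-- A PERFECT MATCHING of `G` ("a minimum-weight perfect matching in `G`"), encoded by the
fixed-point-free involution `τ` exchanging the two ends of each matching edge: `τ(τ(i)) = i` and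
`{i, τ(i)}` is an edge of `G` for every vertex `i` (rendering, disclosed in the module docstring;
faithful by `IsPerfectMatching.exists_subgraph` / `exists_isPerfectMatching_of_subgraph`).
[cite: MulmuleySohoniSIAM2001, §4.2 (AV p.18, all.txt L1243)] -/
def IsPerfectMatching (τ : Equiv.Perm (Fin m)) : Prop := (∀ i, τ (τ i) = i) ∧ ∀ i, G.Adj i (τ i)

/-- The weight `∑_{e ∈ τ} w_e` of the perfect matching `τ`. [folklore] -/
def matchingWeight (τ : Equiv.Perm (Fin m)) : ℕ := ∑ e ∈ edges τ, w e

/-- `W`, "the weight of a minimum-weight perfect matching in `G`" (and `0` if `G` has no perfect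
matching). [cite: MulmuleySohoniSIAM2001, §4.2 (AV p.18, all.txt L1243)] -/
def minMatchingWeight : ℕ :=
  sInf {n | ∃ τ, IsPerfectMatching G τ ∧ matchingWeight w τ = n}

/-- A minimum-weight perfect matching. [cite: MulmuleySohoniSIAM2001, §4.2 (AV p.18, all.txt L1243–1248)] -/
def IsMinPerfectMatching (τ : Equiv.Perm (Fin m)) : Prop :=
  IsPerfectMatching G τ ∧ matchingWeight w τ = minMatchingWeight G w

/-- "permutations […] whose cycle graphs can be decomposed as the union of two minimum-weight
perfect matchings, not necessarily distinct". [cite: MulmuleySohoniSIAM2001, §4.2 (AV p.18,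
all.txt L1246–1248)] -/
def IsUnionOfTwoMinMatchings (σ : Equiv.Perm (Fin m)) : Prop :=
  ∃ τ₁ τ₂, IsMinPerfectMatching G w τ₁ ∧ IsMinPerfectMatching G w τ₂ ∧
    edges σ = edges τ₁ ∪ edges τ₂

/-- The exponent `∑_i w_{i σ(i)}` of `t` picked up by the Leibniz term of `σ` under the
one-parameter subgroup `α(t) : y_{ij} ↦ t^{w_{ij}} y_{ij}`.
[cite: MulmuleySohoniSIAM2001, §4.2 (AV p.17, all.txt L1226–1241)] -/
def texp (σ : Equiv.Perm (Fin m)) : ℕ := ∑ i, w s(i, σ i)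

variable {G w}

/-- `σ⁻¹ (σ x) = x`. [folklore] -/
private theorem perm_inv_apply_self (σ : Equiv.Perm (Fin m)) (x : Fin m) : σ⁻¹ (σ x) = x :=
  σ.symm_apply_apply x

/-- `σ (σ⁻¹ x) = x`. [folklore] -/
private theorem perm_apply_inv_self (σ : Equiv.Perm (Fin m)) (x : Fin m) : σ (σ⁻¹ x) = x :=
  σ.apply_symm_apply x

/-- A permutation of nonzero weight has no fixed point. [folklore] -/
private theorem IsOnGraph.ne {σ : Equiv.Perm (Fin m)} (hσ : IsOnGraph G σ) (i : Fin m) :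
    σ i ≠ i :=
  fun h => by
    have h' := hσ i
    rw [h] at h'
    exact G.irrefl h'

/-- `W ≤` the weight of any perfect matching. [folklore] -/
private theorem minMatchingWeight_le {τ : Equiv.Perm (Fin m)} (hτ : IsPerfectMatching G τ) :
    minMatchingWeight G w ≤ matchingWeight w τ :=
  Nat.sInf_le ⟨τ, hτ, rfl⟩

/-- `W` is attained: if `G` has a perfect matching it has a minimum-weight one. [folklore] -/
private theorem exists_isMinPerfectMatching (h : ∃ τ, IsPerfectMatching G τ) :
    ∃ τ, IsMinPerfectMatching G w τ := by
  have hne : {n | ∃ τ, IsPerfectMatching G τ ∧ matchingWeight w τ = n}.Nonempty := by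
    obtain ⟨τ, hτ⟩ := h
    exact ⟨_, τ, hτ, rfl⟩
  obtain ⟨τ, hτ, hn⟩ := Nat.sInf_mem hne
  exact ⟨τ, hτ, hn⟩

/-! ### The encoding of perfect matchings by involutions is faithful -/

/-- An involution-encoded perfect matching IS a perfect matching of `G` in Mathlib's sense
(`SimpleGraph.Subgraph.IsPerfectMatching`), with matching edges `{v, τ(v)}` — faithfulness of the
encoding of the print's "perfect matching in `G`".
[cite: MulmuleySohoniSIAM2001, §4.2 (AV p.18, all.txt L1243)] -/
theorem IsPerfectMatching.exists_subgraph {τ : Equiv.Perm (Fin m)} (hτ : IsPerfectMatching G τ) :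
    ∃ M : G.Subgraph, M.IsPerfectMatching ∧ ∀ v u, M.Adj v u ↔ u = τ v := by
  let M : G.Subgraph :=
    { verts := Set.univ
      Adj := fun v u => u = τ v
      adj_sub := fun {v u} h => by subst h; exact hτ.2 v
      edge_vert := fun _ => Set.mem_univ _
      symm := ⟨fun v u h => by rw [h, hτ.1]⟩ }
  exact ⟨M, ⟨fun v _ => ⟨τ v, rfl, fun u hu => hu⟩, fun v => Set.mem_univ v⟩, fun v u => Iff.rfl⟩

/-- Conversely every perfect matching of `G` in Mathlib's sense is encoded by an involution —
faithfulness of the encoding of the print's "perfect matching in `G`".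
[cite: MulmuleySohoniSIAM2001, §4.2 (AV p.18, all.txt L1243)] -/
theorem exists_isPerfectMatching_of_subgraph {M : G.Subgraph} (hM : M.IsPerfectMatching) :
    ∃ τ, IsPerfectMatching G τ ∧ ∀ v, M.Adj v (τ v) := by
  classical
  have h : ∀ v, ∃! u, M.Adj v u := fun v => hM.1 (hM.2 v)
  choose f hf using h
  have hinv : Function.Involutive f := fun v => ((hf (f v)).2 v (M.adj_symm (hf v).1)).symm
  exact ⟨Function.Involutive.toPerm f hinv, ⟨hinv, fun v => M.adj_sub (hf v).1⟩, fun v => (hf v).1⟩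

/-- `∑_i w_{i σ⁻¹(i)} = ∑_i w_{i σ(i)}`. [folklore] -/
private theorem sum_weight_inv (σ : Equiv.Perm (Fin m)) :
    ∑ i, w s(i, σ⁻¹ i) = texp w σ := by
  rw [texp, ← Equiv.sum_comp σ (fun i => w s(i, σ⁻¹ i))]
  refine Finset.sum_congr rfl fun i _ => ?_
  rw [perm_inv_apply_self, Sym2.eq_swap]

/-- Each matching edge is met from both of its ends: `∑_i w_{i τ(i)} = 2 · weight(τ)`. [folklore] -/
private theorem texp_eq_two_mul_matchingWeight {τ : Equiv.Perm (Fin m)}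
    (hτ : IsPerfectMatching G τ) : texp w τ = 2 * matchingWeight w τ := by
  classical
  unfold texp matchingWeight edges
  rw [← Finset.sum_fiberwise_of_maps_to (s := univ) (t := univ.image fun i => s(i, τ i))
    (g := fun i => s(i, τ i)) (fun i hi => mem_image_of_mem _ hi) (fun i => w s(i, τ i)),
    Finset.mul_sum]
  refine Finset.sum_congr rfl fun e he => ?_
  obtain ⟨x₀, -, rfl⟩ := mem_image.mp he
  have hfib : univ.filter (fun i => s(i, τ i) = s(x₀, τ x₀)) = {x₀, τ x₀} := by
    ext i
    simp only [mem_filter, mem_univ, true_and, mem_insert, mem_singleton, Sym2.eq_iff]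
    constructor
    · rintro (⟨h, -⟩ | ⟨h, -⟩) <;> simp [h]
    · rintro (rfl | rfl)
      · exact Or.inl ⟨rfl, rfl⟩
      · exact Or.inr ⟨rfl, hτ.1 x₀⟩
  rw [hfib, Finset.sum_pair (hτ.2 x₀).ne, hτ.1 x₀, Sym2.eq_swap (a := τ x₀), two_mul]

/-! ### From an alternating colouring to a pair of perfect matchings -/

/-- The matching "follow `σ` from the vertices of one colour, `σ⁻¹` from the others". [folklore] -/
private def matchOf (σ : Equiv.Perm (Fin m)) (col : Fin m → Bool) : Fin m → Fin m :=
  fun x => if col x then σ x else σ⁻¹ x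

/-- For an alternating colouring the matching map is an involution. [folklore] -/
private theorem matchOf_matchOf {σ : Equiv.Perm (Fin m)} {col : Fin m → Bool}
    (hcol : ∀ x, col (σ x) = !col x) (x : Fin m) : matchOf σ col (matchOf σ col x) = x := by
  unfold matchOf
  cases hx : col x
  · have h1 : col (σ⁻¹ x) = true := by
      have := hcol (σ⁻¹ x)
      rw [perm_apply_inv_self, hx] at this
      revert this
      cases col (σ⁻¹ x) <;> simp
    rw [if_neg (show ¬(false = true) by decide), if_pos h1, perm_apply_inv_self]
  · have h1 : col (σ x) = false := by rw [hcol, hx]; rfl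
    rw [if_pos rfl, if_neg (by rw [h1]; decide), perm_inv_apply_self]

/-- The matching as a permutation. [folklore] -/
private def matchPerm (σ : Equiv.Perm (Fin m)) (col : Fin m → Bool)
    (hcol : ∀ x, col (σ x) = !col x) : Equiv.Perm (Fin m) :=
  Function.Involutive.toPerm (matchOf σ col) (matchOf_matchOf hcol)

/-- Unfolding `matchPerm`. [folklore] -/
private theorem matchPerm_apply {σ : Equiv.Perm (Fin m)} {col : Fin m → Bool}
    (hcol : ∀ x, col (σ x) = !col x) (x : Fin m) :
    matchPerm σ col hcol x = if col x then σ x else σ⁻¹ x := rfl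

/-- The opposite colouring alternates as well. [folklore] -/
private theorem not_coloring {σ : Equiv.Perm (Fin m)} {col : Fin m → Bool}
    (hcol : ∀ x, col (σ x) = !col x) : ∀ x, (fun y => !col y) (σ x) = !(fun y => !col y) x :=
  fun x => by simp [hcol x]

/-- Both colour classes give perfect matchings of `G`. [folklore] -/
private theorem isPerfectMatching_matchPerm {σ : Equiv.Perm (Fin m)} (hσ : IsOnGraph G σ)
    {col : Fin m → Bool} (hcol : ∀ x, col (σ x) = !col x) :
    IsPerfectMatching G (matchPerm σ col hcol) := by
  refine ⟨matchOf_matchOf hcol, fun i => ?_⟩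
  rw [matchPerm_apply]
  split_ifs
  · exact hσ i
  · have := hσ (σ⁻¹ i)
    rw [perm_apply_inv_self] at this
    exact this.symm

/-- The two matchings together meet every vertex exactly like `σ` and `σ⁻¹`:
`weight(τ₁) + weight(τ₂) = ∑_i w_{i σ(i)}`. [folklore] -/
private theorem matchingWeight_add_of_coloring {σ : Equiv.Perm (Fin m)} (hσ : IsOnGraph G σ)
    {col : Fin m → Bool} (hcol : ∀ x, col (σ x) = !col x) :
    matchingWeight w (matchPerm σ col hcol) +
        matchingWeight w (matchPerm σ (fun y => !col y) (not_coloring hcol)) = texp w σ := by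
  have h2 : texp w (matchPerm σ col hcol) +
      texp w (matchPerm σ (fun y => !col y) (not_coloring hcol)) = 2 * texp w σ := by
    unfold texp
    rw [← Finset.sum_add_distrib]
    have hpt : ∀ x, w s(x, matchPerm σ col hcol x) +
        w s(x, matchPerm σ (fun y => !col y) (not_coloring hcol) x) =
        w s(x, σ x) + w s(x, σ⁻¹ x) := by
      intro x
      rw [matchPerm_apply, matchPerm_apply]
      cases col x <;> simp [add_comm]
    rw [Finset.sum_congr rfl fun x _ => hpt x, Finset.sum_add_distrib, sum_weight_inv, texp,
      two_mul]
  rw [texp_eq_two_mul_matchingWeight (isPerfectMatching_matchPerm hσ hcol),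
    texp_eq_two_mul_matchingWeight (isPerfectMatching_matchPerm hσ (col := fun y => !col y) (not_coloring hcol))] at h2
  omega

/-- The cycle graph of `σ` is the union of the two matchings. [folklore] -/
private theorem edges_eq_of_coloring {σ : Equiv.Perm (Fin m)}
    {col : Fin m → Bool} (hcol : ∀ x, col (σ x) = !col x) :
    edges σ = edges (matchPerm σ col hcol) ∪
      edges (matchPerm σ (fun y => !col y) (not_coloring hcol)) := by
  classical
  ext e
  simp only [edges, mem_union, mem_image, mem_univ, true_and, matchPerm_apply]
  constructor
  · rintro ⟨x, rfl⟩
    cases hx : col x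
    · exact Or.inr ⟨x, by simp [hx]⟩
    · exact Or.inl ⟨x, by simp [hx]⟩
  · rintro (⟨x, rfl⟩ | ⟨x, rfl⟩)
    · cases hx : col x
      · exact ⟨σ⁻¹ x, by simp [Sym2.eq_swap]⟩
      · exact ⟨x, by simp⟩
    · cases hx : col x
      · exact ⟨x, by simp⟩
      · exact ⟨σ⁻¹ x, by simp [Sym2.eq_swap]⟩

/-! ### The exponent of `t` versus `2W` -/

/-- **`∑_i w_{i σ(i)} ≥ 2W`** for every permutation of nonzero weight with even cycle graph: its
cycle graph splits into two perfect matchings. [cite: MulmuleySohoniSIAM2001, §4.2 (AV pp.17–18,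
all.txt L1241–1248)] -/
theorem two_mul_minMatchingWeight_le_texp {σ : Equiv.Perm (Fin m)} (hσ : IsOnGraph G σ)
    (heven : ∀ c ∈ σ.cycleType, Even c) : 2 * minMatchingWeight G w ≤ texp w σ := by
  classical
  obtain ⟨col, hcol'⟩ := exists_coloring σ heven
  have hcol : ∀ x, col (σ x) = !col x := fun x => hcol' x (hσ.ne x)
  rw [← matchingWeight_add_of_coloring (w := w) hσ hcol]
  have h1 := minMatchingWeight_le (w := w) (isPerfectMatching_matchPerm hσ hcol)
  have h2 := minMatchingWeight_le (w := w) (isPerfectMatching_matchPerm hσ (col := fun y => !col y) (not_coloring hcol))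
  omega

/-- A permutation of nonzero weight with even cycle graph yields a perfect matching of `G`.
[folklore] -/
private theorem exists_isPerfectMatching_of_isOnGraph {σ : Equiv.Perm (Fin m)}
    (hσ : IsOnGraph G σ) (heven : ∀ c ∈ σ.cycleType, Even c) : ∃ τ, IsPerfectMatching G τ := by
  classical
  obtain ⟨col, hcol'⟩ := exists_coloring σ heven
  have hcol : ∀ x, col (σ x) = !col x := fun x => hcol' x (hσ.ne x)
  exact ⟨_, isPerfectMatching_matchPerm hσ hcol⟩

/-- If the matching `τ` lies inside the cycle graph of `σ`, then `τ(x) ∈ {σ(x), σ⁻¹(x)}` at every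
vertex. [folklore] -/
private theorem apply_eq_or_of_edges_subset {σ τ : Equiv.Perm (Fin m)} (hτ : edges τ ⊆ edges σ)
    (x : Fin m) : τ x = σ x ∨ τ x = σ⁻¹ x := by
  classical
  have hx : s(x, τ x) ∈ edges σ := hτ (mem_image_of_mem _ (mem_univ x))
  obtain ⟨y, -, hy⟩ := mem_image.mp hx
  rcases Sym2.eq_iff.mp hy with ⟨rfl, h⟩ | ⟨h, h'⟩
  · exact Or.inl h.symm
  · right
    rw [Equiv.Perm.eq_inv_iff_eq, ← h, h']

/-- If the cycle graph of `σ` (of nonzero weight) contains a perfect matching `τ`, then every cycle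
of `σ` has even length: `τ` restricts to a fixed-point-free involution of the vertex set of each
cycle. [folklore] -/
private theorem even_of_mem_cycleType_of_edges_subset {σ τ : Equiv.Perm (Fin m)}
    (hσ : IsOnGraph G σ) (h1 : ∀ i, τ (τ i) = i) (hτ : edges τ ⊆ edges σ) :
    ∀ c ∈ σ.cycleType, Even c := by
  classical
  have hi := apply_eq_or_of_edges_subset hτ
  intro c hc
  rw [Equiv.Perm.cycleType_def] at hc
  obtain ⟨C, hC, rfl⟩ := Multiset.mem_map.mp hc
  have hC' : C ∈ σ.cycleFactorsFinset := Finset.mem_def.mpr hC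
  simp only [Function.comp_apply]
  -- `τ` preserves the vertex set of the cycle `C`
  have hstab : ∀ y ∈ C.support, τ y ∈ C.support := by
    intro y hy
    have hCeq := Equiv.Perm.cycle_is_cycleOf hy hC'
    rw [hCeq, Equiv.Perm.mem_support_cycleOf_iff' (hσ.ne y)]
    rcases hi y with h | h
    · rw [h]; exact Equiv.Perm.sameCycle_apply_right.mpr (Equiv.Perm.SameCycle.refl _ _)
    · rw [h]; exact Equiv.Perm.sameCycle_symm_apply_right.mpr (Equiv.Perm.SameCycle.refl _ _)
  -- the restriction of `τ` to that vertex set is a fixed-point-free involution of it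
  let f : Fin m → Fin m := fun y => if y ∈ C.support then τ y else y
  have hf : Function.Involutive f := by
    intro y
    by_cases hy : y ∈ C.support
    · simp only [f, if_pos hy, if_pos (hstab y hy), h1]
    · simp only [f, if_neg hy]
  have hsupp : (Function.Involutive.toPerm f hf).support = C.support := by
    ext y
    rw [Equiv.Perm.mem_support]
    change f y ≠ y ↔ _
    by_cases hy : y ∈ C.support
    · simp only [f, if_pos hy, hy, iff_true]
      rcases hi y with h | h
      · rw [h]; exact hσ.ne y
      · rw [h]
        intro h'
        have := congrArg σ h'
        rw [perm_apply_inv_self] at this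
        exact hσ.ne y this.symm
    · simp only [f, if_neg hy, hy, iff_false, ne_eq, not_not]
  have hsq : Function.Involutive.toPerm f hf ^ 2 = 1 := by
    ext y
    rw [sq, Equiv.Perm.mul_apply]
    exact congrArg Fin.val (hf y)
  have h2 := Equiv.Perm.two_dvd_card_support hsq
  rw [hsupp] at h2
  exact even_iff_two_dvd.mpr h2

/-- If the cycle graph of `σ` is the union of two perfect matchings `τ₁, τ₂` (as involutions),
then `∑_i w_{i τ₁(i)} + ∑_i w_{i τ₂(i)} = 2 ∑_i w_{i σ(i)}`: at every vertex `{τ₁(x), τ₂(x)} =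
{σ(x), σ⁻¹(x)}` as multisets. [folklore] -/
private theorem texp_add_texp_of_edges_eq {σ τ₁ τ₂ : Equiv.Perm (Fin m)}
    (h1 : ∀ i, τ₁ (τ₁ i) = i) (h2 : ∀ i, τ₂ (τ₂ i) = i)
    (hE : edges σ = edges τ₁ ∪ edges τ₂) : texp w τ₁ + texp w τ₂ = 2 * texp w σ := by
  classical
  -- (i) each `τ_r(x)` is `σ(x)` or `σ⁻¹(x)`
  have hi1 := apply_eq_or_of_edges_subset (σ := σ) (τ := τ₁) (hE ▸ subset_union_left)
  have hi2 := apply_eq_or_of_edges_subset (σ := σ) (τ := τ₂) (hE ▸ subset_union_right)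
  -- (ii) each `σ(x)` is `τ₁(x)` or `τ₂(x)`
  have hii : ∀ x, σ x = τ₁ x ∨ σ x = τ₂ x := by
    intro x
    have hx : s(x, σ x) ∈ edges τ₁ ∪ edges τ₂ := hE ▸ mem_image_of_mem _ (mem_univ x)
    have aux : ∀ τ : Equiv.Perm (Fin m), (∀ i, τ (τ i) = i) → s(x, σ x) ∈ edges τ → σ x = τ x := by
      intro τ hτ hmem
      obtain ⟨y, -, hy⟩ := mem_image.mp hmem
      rcases Sym2.eq_iff.mp hy with ⟨rfl, h⟩ | ⟨h, h'⟩
      · exact h.symm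
      · subst h
        have := congrArg τ h'
        rw [hτ] at this
        exact this
    rcases mem_union.mp hx with h | h
    · exact Or.inl (aux τ₁ h1 h)
    · exact Or.inr (aux τ₂ h2 h)
  -- pointwise identity
  have hpt : ∀ x, w s(x, τ₁ x) + w s(x, τ₂ x) = w s(x, σ x) + w s(x, σ⁻¹ x) := by
    intro x
    by_cases hxx : σ x = σ⁻¹ x
    · have e1 : τ₁ x = σ x := by rcases hi1 x with h | h; exact h; rw [h, hxx]
      have e2 : τ₂ x = σ x := by rcases hi2 x with h | h; exact h; rw [h, hxx]
      rw [e1, e2, ← hxx]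
    · rcases hii x with h | h
      · have e2 : τ₂ x = σ⁻¹ x := by
          rcases hi2 x with h' | h'
          · exfalso
            rcases hii (σ⁻¹ x) with h'' | h''
            · rw [perm_apply_inv_self] at h''
              have : τ₁ x = σ⁻¹ x := by have e := congrArg τ₁ h''; rwa [h1] at e
              exact hxx (h.trans this)
            · rw [perm_apply_inv_self] at h''
              have : τ₂ x = σ⁻¹ x := by have e := congrArg τ₂ h''; rwa [h2] at e
              exact hxx (h'.symm.trans this)
          · exact h'
        rw [← h, e2]
      · have e1 : τ₁ x = σ⁻¹ x := by
          rcases hi1 x with h' | h'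
          · exfalso
            rcases hii (σ⁻¹ x) with h'' | h''
            · rw [perm_apply_inv_self] at h''
              have : τ₁ x = σ⁻¹ x := by have e := congrArg τ₁ h''; rwa [h1] at e
              exact hxx (h'.symm.trans this)
            · rw [perm_apply_inv_self] at h''
              have : τ₂ x = σ⁻¹ x := by have e := congrArg τ₂ h''; rwa [h2] at e
              exact hxx (h.trans this)
          · exact h'
        rw [← h, e1, add_comm]
  unfold texp
  rw [← Finset.sum_add_distrib, Finset.sum_congr rfl fun x _ => hpt x, Finset.sum_add_distrib,
    sum_weight_inv, texp, two_mul]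

/-- **The exponent equals `2W` exactly for the permutations of `h(Y)`**: for `σ` of nonzero weight
with even cycle graph, `∑_i w_{i σ(i)} = 2W` iff the cycle graph of `σ` is the union of two
minimum-weight perfect matchings (not necessarily distinct).
[cite: MulmuleySohoniSIAM2001, §4.2 (AV p.18, all.txt L1243–1248)] -/
theorem texp_eq_two_mul_minMatchingWeight_iff {σ : Equiv.Perm (Fin m)} (hσ : IsOnGraph G σ)
    (heven : ∀ c ∈ σ.cycleType, Even c) :
    texp w σ = 2 * minMatchingWeight G w ↔ IsUnionOfTwoMinMatchings G w σ := by
  classical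
  constructor
  · intro h
    obtain ⟨col, hcol'⟩ := exists_coloring σ heven
    have hcol : ∀ x, col (σ x) = !col x := fun x => hcol' x (hσ.ne x)
    have hsum := matchingWeight_add_of_coloring (w := w) hσ hcol
    have h1 := minMatchingWeight_le (w := w) (isPerfectMatching_matchPerm hσ hcol)
    have h2 := minMatchingWeight_le (w := w) (isPerfectMatching_matchPerm hσ (col := fun y => !col y) (not_coloring hcol))
    exact ⟨_, _, ⟨isPerfectMatching_matchPerm hσ hcol, by omega⟩,
      ⟨isPerfectMatching_matchPerm hσ (col := fun y => !col y) (not_coloring hcol), by omega⟩, edges_eq_of_coloring hcol⟩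
  · rintro ⟨τ₁, τ₂, ⟨hτ₁, hw₁⟩, ⟨hτ₂, hw₂⟩, hE⟩
    have h := texp_add_texp_of_edges_eq (w := w) hτ₁.1 hτ₂.1 hE
    rw [texp_eq_two_mul_matchingWeight hτ₁, texp_eq_two_mul_matchingWeight hτ₂, hw₁, hw₂] at h
    omega

/-! ### The index sets of eq. (6) and of `h(Y)` -/

variable (G w)

open scoped Classical in
/-- The index set of eq. (6): the permutations of nonzero weight whose cycle graphs contain only
cycles of even length. [cite: MulmuleySohoniSIAM2001, §4.2 eq. (6) (AV p.17, all.txt L1197–1203)] -/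
def evenPerms : Finset (Equiv.Perm (Fin m)) :=
  univ.filter fun σ => IsOnGraph G σ ∧ ∀ c ∈ σ.cycleType, Even c

open scoped Classical in
/-- The index set of `h(Y)`: "all permutations with nonzero weight whose cycle graphs can be
decomposed as the union of two minimum-weight perfect matchings, not necessarily distinct".
[cite: MulmuleySohoniSIAM2001, §4.2 (AV p.18, all.txt L1246–1248)] -/
def hPerms : Finset (Equiv.Perm (Fin m)) :=
  univ.filter fun σ => IsOnGraph G σ ∧ IsUnionOfTwoMinMatchings G w σ

variable {G w}

/-- Membership in `evenPerms`. [folklore] -/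
private theorem mem_evenPerms {σ : Equiv.Perm (Fin m)} :
    σ ∈ evenPerms G ↔ IsOnGraph G σ ∧ ∀ c ∈ σ.cycleType, Even c := by
  classical
  simp [evenPerms]

/-- Membership in `hPerms`. [folklore] -/
private theorem mem_hPerms {σ : Equiv.Perm (Fin m)} :
    σ ∈ hPerms G w ↔ IsOnGraph G σ ∧ IsUnionOfTwoMinMatchings G w σ := by
  classical
  simp [hPerms]

/-- The permutations of `h(Y)` occur in eq. (6): a cycle graph that is a union of perfect matchings
has only even cycles. [cite: MulmuleySohoniSIAM2001, §4.2 (AV pp.17–18, all.txt L1197–1248)] -/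
theorem hPerms_subset_evenPerms : hPerms G w ⊆ evenPerms G := by
  intro σ hσ
  obtain ⟨h1, τ₁, τ₂, hτ₁, -, hE⟩ := mem_hPerms.mp hσ
  exact mem_evenPerms.mpr ⟨h1,
    even_of_mem_cycleType_of_edges_subset h1 hτ₁.1.1 (hE ▸ subset_union_left)⟩

/-- `{σ ∈ evenPerms | texp σ = 2W} = hPerms`. [folklore] -/
private theorem filter_texp_eq :
    (evenPerms G).filter (fun σ => texp w σ = 2 * minMatchingWeight G w) = hPerms G w := by
  ext σ
  simp only [Finset.mem_filter, mem_evenPerms]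
  constructor
  · rintro ⟨⟨h1, h2⟩, h3⟩
    exact mem_hPerms.mpr ⟨h1, (texp_eq_two_mul_minMatchingWeight_iff h1 h2).mp h3⟩
  · intro h
    obtain ⟨h1, h2⟩ := mem_evenPerms.mp (hPerms_subset_evenPerms h)
    exact ⟨⟨h1, h2⟩, (texp_eq_two_mul_minMatchingWeight_iff h1 h2).mpr (mem_hPerms.mp h).2⟩

/-- **`W` is the weight of a minimum-weight perfect matching**: as soon as eq. (6) has a term,
`G` has a perfect matching (two, from the even cycle graph) and the minimum weight is attained.
[cite: MulmuleySohoniSIAM2001, §4.2 (AV p.18, all.txt L1243)] -/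
theorem exists_isMinPerfectMatching_of_mem_evenPerms {σ : Equiv.Perm (Fin m)}
    (hσ : σ ∈ evenPerms G) : ∃ τ, IsMinPerfectMatching G w τ :=
  exists_isMinPerfectMatching
    (exists_isPerfectMatching_of_isOnGraph (mem_evenPerms.mp hσ).1 (mem_evenPerms.mp hσ).2)

end Graph

/-! ## §3. The Tutte matrix, its Leibniz terms, `D(Y) = det(α(t)M)` and `h(Y)` -/

section Tutte

variable (k : Type*) [Field k] {m : ℕ} (G : SimpleGraph (Fin m)) [DecidableRel G.Adj]
  (w : Sym2 (Fin m) → ℕ)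

/-- The skew-symmetric TUTTE MATRIX `M` of `G`: "whose `(i, j)`-th entry `M_{ij}`, `i < j`, is the
variable `y_{ij}` if `G` has an edge joining vertices `i` and `j`, and zero otherwise" (and
`M_{ji} = -M_{ij}`); the variable `y_{ij}` is the entry variable `x_{(i,j)}` of the `m × m` variable
matrix `Y`, so that `M` lives over the coordinate ring of `det(Y)`.
[cite: MulmuleySohoniSIAM2001, §4.2 (AV p.17, all.txt L1184–1188)] -/
def tutteMatrix : Matrix (Fin m) (Fin m) (MvPolynomial (Fin m × Fin m) k) :=
  Matrix.of fun i j => if G.Adj i j then (if i < j then X (i, j) else -X (j, i)) else 0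

/-- The MODIFIED TUTTE MATRIX `M̃ = α(t)(M)`: "replacing every variable `y_{ij}`, if it indeed occurs
in `M`, by `t^{w_{ij}} y_{ij}`". [cite: MulmuleySohoniSIAM2001, §4.2 (AV p.17, all.txt L1226–1233)] -/
def tutteMatrixScaled (t : k) : Matrix (Fin m) (Fin m) (MvPolynomial (Fin m × Fin m) k) :=
  Matrix.of fun i j => C (t ^ w s(i, j)) * tutteMatrix k G i j

/-- The Leibniz term `sign(σ) wt(σ)`, "`wt(σ)` is the product of the entries `M_{iσ(i)}`".
[cite: MulmuleySohoniSIAM2001, §4.2 (AV p.17, all.txt L1190–1194)] -/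
def permTerm (σ : Equiv.Perm (Fin m)) : MvPolynomial (Fin m × Fin m) k :=
  ((Equiv.Perm.sign σ : ℤ) : MvPolynomial (Fin m × Fin m) k) * ∏ i, tutteMatrix k G i (σ i)

/-- **`h(Y) = ∑_σ sign(σ) wt(σ)`** over the permutations of nonzero weight (of eq. (6)) whose cycle
graphs decompose as the union of two minimum-weight perfect matchings.
[cite: MulmuleySohoniSIAM2001, §4.2 (AV p.18, all.txt L1244–1248)] -/
def tutteInitialForm : MvPolynomial (Fin m × Fin m) k := ∑ σ ∈ hPerms G w, permTerm k G σ

variable {G w}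

variable {k}

/-- `M` is skew-symmetric. [folklore] -/
private theorem tutteMatrix_swap (i j : Fin m) : tutteMatrix k G j i = -tutteMatrix k G i j := by
  simp only [tutteMatrix, Matrix.of_apply]
  by_cases hij : G.Adj i j
  · have hji : G.Adj j i := hij.symm
    have hne : i ≠ j := hij.ne
    rw [if_pos hij, if_pos hji]
    rcases lt_or_gt_of_ne hne with h | h
    · rw [if_pos h, if_neg (not_lt.mpr h.le)]
    · rw [if_neg (not_lt.mpr h.le), if_pos h, neg_neg]
  · have hji : ¬ G.Adj j i := fun h => hij h.symm
    rw [if_neg hij, if_neg hji, neg_zero]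

/-- `M̃` is skew-symmetric. [folklore] -/
private theorem tutteMatrixScaled_swap (t : k) (i j : Fin m) :
    tutteMatrixScaled k G w t j i = -tutteMatrixScaled k G w t i j := by
  simp only [tutteMatrixScaled, Matrix.of_apply]
  rw [tutteMatrix_swap, Sym2.eq_swap, mul_neg]

/-- `M̃` has zero diagonal. [folklore] -/
private theorem tutteMatrixScaled_diag (t : k) (i : Fin m) : tutteMatrixScaled k G w t i i = 0 := by
  simp [tutteMatrixScaled, tutteMatrix]

/-- `α(1) = id`: `M̃ = M` at `t = 1`. [folklore] -/
private theorem tutteMatrixScaled_one : tutteMatrixScaled k G w 1 = tutteMatrix k G := by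
  ext i j
  simp [tutteMatrixScaled]

/-- A term of zero weight vanishes. [folklore] -/
private theorem permTerm_eq_zero_of_not_isOnGraph {σ : Equiv.Perm (Fin m)} (h : ¬ IsOnGraph G σ) :
    permTerm k G σ = 0 := by
  unfold IsOnGraph at h
  push Not at h
  obtain ⟨i, hi⟩ := h
  rw [permTerm, Finset.prod_eq_zero (Finset.mem_univ i) (by simp [tutteMatrix, hi]), mul_zero]

/-- The Leibniz term of `σ` for `M̃`: `sign(σ) ∏_i M̃_{iσ(i)} = t^{texp σ} · sign(σ) wt(σ)`.
[folklore] -/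
private theorem sign_smul_prod_tutteMatrixScaled (t : k) (σ : Equiv.Perm (Fin m)) :
    Equiv.Perm.sign σ • ∏ i, tutteMatrixScaled k G w t i (σ i) =
      C (t ^ texp w σ) * permTerm k G σ := by
  simp only [tutteMatrixScaled, Matrix.of_apply]
  rw [Finset.prod_mul_distrib, ← map_prod C, Finset.prod_pow_eq_pow_sum, Units.smul_def,
    zsmul_eq_mul, permTerm, texp]
  ring

variable (k G w)

/-- **`D(Y) = det(M̃) = ∑_{σ'} t^{∑_i w_{iσ'(i)}} sign(σ') wt(σ')`**, `σ'` over the permutations of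
nonzero weight with even cycle graph — eq. (6) for the modified Tutte matrix.
[cite: MulmuleySohoniSIAM2001, §4.2 eq. (6) (AV p.17, all.txt L1197–1241)] -/
theorem det_tutteMatrixScaled_eq_sum (t : k) :
    (tutteMatrixScaled k G w t).det = ∑ σ ∈ evenPerms G, C (t ^ texp w σ) * permTerm k G σ := by
  classical
  have hskew : ∀ i j, (tutteMatrixScaled k G w t)ᵀ j i = -(tutteMatrixScaled k G w t)ᵀ i j :=
    fun i j => by rw [Matrix.transpose_apply, Matrix.transpose_apply, tutteMatrixScaled_swap]
  have hdiag : ∀ i, (tutteMatrixScaled k G w t)ᵀ i i = 0 :=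
    fun i => by rw [Matrix.transpose_apply, tutteMatrixScaled_diag]
  rw [← Matrix.det_transpose,
    Literature.LinearAlgebra.Matrix.det_eq_sum_filter_cycleType_even_of_alternating hskew hdiag]
  simp only [Matrix.transpose_apply]
  rw [Finset.sum_congr rfl fun σ _ => sign_smul_prod_tutteMatrixScaled t σ]
  symm
  refine Finset.sum_subset (fun σ hσ => ?_) (fun σ hσ hσ' => ?_)
  · obtain ⟨h1, h2⟩ := mem_evenPerms.mp hσ
    exact Finset.mem_filter.mpr ⟨Finset.mem_univ _, h2,
      Finset.eq_univ_iff_forall.mpr fun i => Equiv.Perm.mem_support.mpr (h1.ne i)⟩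
  · have h2 := (Finset.mem_filter.mp hσ).2.1
    have h1 : ¬ IsOnGraph G σ := fun h => hσ' (mem_evenPerms.mpr ⟨h, h2⟩)
    rw [permTerm_eq_zero_of_not_isOnGraph h1, mul_zero]

/-- **`det(M) = ∑_{σ'} sign(σ') wt(σ')`** over the permutations of nonzero weight with even cycle
graph — eq. (6). [cite: MulmuleySohoniSIAM2001, §4.2 eq. (6) (AV p.17, all.txt L1197–1203)] -/
theorem det_tutteMatrix_eq_sum : (tutteMatrix k G).det = ∑ σ ∈ evenPerms G, permTerm k G σ := by
  rw [← tutteMatrixScaled_one (w := fun _ => 0), det_tutteMatrixScaled_eq_sum]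
  simp

variable {k G w}

/-- A substitution sending every variable to a scalar multiple of a variable is a linear
substitution: its value on `f` lies in `End · f`. [folklore] -/
private theorem aeval_smul_X_mem_endOrbit {ι : Type*} [Fintype ι] [DecidableEq ι] (c : ι → k)
    (r : ι → ι) (f : MvPolynomial ι k) :
    aeval (fun i => c i • (X (r i) : MvPolynomial ι k)) f ∈ endOrbit ι k f := by
  refine ⟨Matrix.of fun j i => if j = r i then c i else 0, ?_⟩
  suffices h : linSubst ι k (Matrix.of fun j i => if j = r i then c i else 0) =
      aeval (fun i => c i • (X (r i) : MvPolynomial ι k)) from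
    congrArg (fun φ : MvPolynomial ι k →ₐ[k] MvPolynomial ι k => φ f) h
  apply MvPolynomial.algHom_ext
  intro i
  simp [linSubst_X, Matrix.of_apply, ite_smul]

variable (k G w)

/-- **"Clearly `D(Y) = det(M̃)` belongs to the projective orbit closure `Δ[det(Y)]` for every
`t`"**: it is the image of `det(Y)` under the linear substitution `y_{ij} ↦ ± t^{w_{ij}} y` / `0`.
[cite: MulmuleySohoniSIAM2001, §4.2 (AV p.18, all.txt L1248–1249)] -/
theorem det_tutteMatrixScaled_mem_endOrbit (t : k) :
    (tutteMatrixScaled k G w t).det ∈ endOrbit (Fin m × Fin m) k (detPoly (Fin m) k) := by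
  classical
  let c : Fin m × Fin m → k := fun p =>
    if G.Adj p.1 p.2 then (if p.1 < p.2 then t ^ w s(p.1, p.2) else -(t ^ w s(p.1, p.2))) else 0
  let r : Fin m × Fin m → Fin m × Fin m := fun p => if p.1 < p.2 then p else (p.2, p.1)
  have h := aeval_smul_X_mem_endOrbit c r (detPoly (Fin m) k)
  convert h using 1
  rw [detPoly, AlgHom.map_det, AlgHom.mapMatrix_apply]
  congr 1
  ext i j : 2
  simp only [Matrix.map_apply, Matrix.mvPolynomialX_apply, aeval_X, tutteMatrixScaled, tutteMatrix,
    Matrix.of_apply, c, r]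
  by_cases hij : G.Adj i j
  · by_cases hlt : i < j
    · simp [hij, hlt, smul_eq_C_mul]
    · simp [hij, hlt, smul_eq_C_mul]
  · simp [hij]

/-- `det(M) ∈ End · det(Y)`. [cite: MulmuleySohoniSIAM2001, §4.2 (AV p.18, all.txt L1248–1249)] -/
theorem det_tutteMatrix_mem_endOrbit :
    (tutteMatrix k G).det ∈ endOrbit (Fin m × Fin m) k (detPoly (Fin m) k) := by
  rw [← tutteMatrixScaled_one (w := fun _ => 0)]
  exact det_tutteMatrixScaled_mem_endOrbit k G (fun _ => 0) 1

end Tutte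

/-! ## §4. `D(Y) = t^{2W} h(Y) + higher order terms`, and `h(Y) ∈ Δ[det(Y)]` -/

section Main

variable (k : Type*) [Field k] {m : ℕ} (G : SimpleGraph (Fin m)) [DecidableRel G.Adj]
  (w : Sym2 (Fin m) → ℕ)

/-- **GCT I §4.2: "`D(Y) = det(M̃) = t^{2W} h(Y) +` higher order terms in `t`, where `W` is the
weight of a minimum-weight perfect matching in `G` and `h(Y) = ∑_σ sign(σ) wt(σ)`, where `σ` ranges
over all permutations with nonzero weight whose cycle graphs can be decomposed as the union of two
minimum-weight perfect matchings"**: the remaining Leibniz terms carry `t^e` with `e > 2W`.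
[cite: MulmuleySohoniSIAM2001, §4.2 (AV pp.17–18, all.txt L1241–1248)] -/
theorem MS2001_sec_4_2_tutte_det_expansion (t : k) :
    (tutteMatrixScaled k G w t).det =
      C (t ^ (2 * minMatchingWeight G w)) * tutteInitialForm k G w +
        ∑ σ ∈ (evenPerms G).filter (fun σ => 2 * minMatchingWeight G w < texp w σ),
          C (t ^ texp w σ) * permTerm k G σ := by
  classical
  rw [det_tutteMatrixScaled_eq_sum, ← Finset.sum_filter_add_sum_filter_not (evenPerms G)
    (fun σ => texp w σ = 2 * minMatchingWeight G w)]
  congr 1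
  · rw [tutteInitialForm, Finset.mul_sum, ← filter_texp_eq]
    refine Finset.sum_congr rfl fun σ hσ => ?_
    rw [(Finset.mem_filter.mp hσ).2]
  · refine Finset.sum_congr (Finset.filter_congr fun σ hσ => ?_) fun _ _ => rfl
    have := two_mul_minMatchingWeight_le_texp (w := w) (mem_evenPerms.mp hσ).1
      (mem_evenPerms.mp hσ).2
    omega

variable {k G w}

/-- The entries of `M` are weighted-homogeneous for the weight `x_{(i,j)} ↦ w_{ij}`:
`M_{ij} ∈ {y_{ij}, -y_{ji}, 0}` has weight `w_{ij}`. [folklore] -/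
private theorem tutteMatrix_isWeightedHomogeneous (i j : Fin m) :
    IsWeightedHomogeneous (fun p : Fin m × Fin m => w s(p.1, p.2)) (tutteMatrix k G i j)
      (w s(i, j)) := by
  simp only [tutteMatrix, Matrix.of_apply]
  split_ifs
  · exact isWeightedHomogeneous_X k (fun p : Fin m × Fin m => w s(p.1, p.2)) (i, j)
  · have h := isWeightedHomogeneous_X k (fun p : Fin m × Fin m => w s(p.1, p.2)) (j, i)
    have hC := isWeightedHomogeneous_C (fun p : Fin m × Fin m => w s(p.1, p.2)) (-1 : k)
    have := hC.mul h
    rw [zero_add, show s(j, i) = s(i, j) from Sym2.eq_swap] at this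
    simpa using this
  · exact isWeightedHomogeneous_zero k _ _

/-- `sign(σ) wt(σ)` is weighted-homogeneous of weight `∑_i w_{iσ(i)}`. [folklore] -/
private theorem permTerm_isWeightedHomogeneous (σ : Equiv.Perm (Fin m)) :
    IsWeightedHomogeneous (fun p : Fin m × Fin m => w s(p.1, p.2)) (permTerm k G σ) (texp w σ) := by
  unfold permTerm texp
  rw [← map_intCast (C : k →+* MvPolynomial (Fin m × Fin m) k)]
  have h0 := isWeightedHomogeneous_C (fun p : Fin m × Fin m => w s(p.1, p.2))
    ((Equiv.Perm.sign σ : ℤ) : k)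
  have hprod := IsWeightedHomogeneous.prod univ (fun i => tutteMatrix k G i (σ i))
    (fun i => w s(i, σ i)) fun i _ => tutteMatrix_isWeightedHomogeneous i (σ i)
  have := h0.mul hprod
  rwa [zero_add] at this

variable (k G w)

/-- **`h(Y)` is the initial form of `det(M)`**: the weight-`2W` component of `det(M)` for the weight
`y_{ij} ↦ w_{ij}` (the coefficient of the least power `t^{2W}` in `D(Y) = det(α(t)M)`).
[cite: MulmuleySohoniSIAM2001, §4.2 (AV p.18, all.txt L1241–1252)] -/
theorem MS2001_sec_4_2_tutteInitialForm_eq_weightedHomogeneousComponent :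
    tutteInitialForm k G w =
      weightedHomogeneousComponent (fun p : Fin m × Fin m => w s(p.1, p.2))
        (2 * minMatchingWeight G w) (tutteMatrix k G).det := by
  classical
  rw [det_tutteMatrix_eq_sum k G, map_sum, tutteInitialForm, ← filter_texp_eq, Finset.sum_filter]
  refine Finset.sum_congr rfl fun σ _ => ?_
  split_ifs with h
  · rw [← h]
    exact ((permTerm_isWeightedHomogeneous σ).weightedHomogeneousComponent_same).symm
  · exact ((permTerm_isWeightedHomogeneous σ).weightedHomogeneousComponent_ne _
      (fun e => h e.symm)).symm

/-- **GCT I §4.2: "`h(Y) = lim_{t→0} t^{-2W} D(Y)` […] belongs to the projective closure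
`Δ[det(Y)]`"** — for every graph `G` on `m` vertices with non-negative integer edge weights, over
every infinite field: `det(M) ∈ End · det(Y) ⊆ Δ[det(Y)]`, all its monomials have weight `≥ 2W`,
and its least-weight component `h(Y)` lies in `Δ[det(M)] ⊆ Δ[det(Y)]` by the one-parameter
subgroup `α(t)` (tree: `weightedHomogeneousComponent_mem_orbitClosure`).
[cite: MulmuleySohoniSIAM2001, §4.2 (AV p.18, all.txt L1248–1252)] -/
theorem MS2001_sec_4_2_tutteInitialForm_mem_orbitClosure [Infinite k] :
    tutteInitialForm k G w ∈ orbitClosure (detPoly (Fin m) k) := by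
  classical
  obtain ⟨A, hA⟩ := det_tutteMatrix_mem_endOrbit k G
  have hmem : (tutteMatrix k G).det ∈ orbitClosure (detPoly (Fin m) k) :=
    endOrbit_subset_orbitClosure_holds _ ⟨A, hA⟩
  rw [MS2001_sec_4_2_tutteInitialForm_eq_weightedHomogeneousComponent]
  rcases Nat.eq_zero_or_pos m with hm | hm
  · subst hm
    have hW : minMatchingWeight G w = 0 := by
      have h0 : matchingWeight w (1 : Equiv.Perm (Fin 0)) = 0 := by
        simp [matchingWeight, edges]
      have := minMatchingWeight_le (G := G) (w := w) (τ := 1) ⟨fun i => i.elim0, fun i => i.elim0⟩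
      omega
    have hdet : (tutteMatrix k G).det = 1 := Matrix.det_isEmpty
    rw [hW, mul_zero, hdet, (isWeightedHomogeneous_one k _).weightedHomogeneousComponent_same,
      ← hdet]
    exact hmem
  · have hhom : ((tutteMatrix k G).det).IsHomogeneous m := by
      rw [← hA]
      simpa using linSubst_isHomogeneous A (detPoly_isHomogeneous (n := Fin m) (k := k))
    have hmin : ∀ d ∈ ((tutteMatrix k G).det).support,
        2 * minMatchingWeight G w ≤ Finsupp.weight (fun p : Fin m × Fin m => w s(p.1, p.2)) d := by
      intro d hd
      rw [mem_support_iff, det_tutteMatrix_eq_sum k G, coeff_sum] at hd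
      obtain ⟨σ, hσ, hne⟩ := Finset.exists_ne_zero_of_sum_ne_zero hd
      rw [permTerm_isWeightedHomogeneous σ hne]
      exact two_mul_minMatchingWeight_le_texp (mem_evenPerms.mp hσ).1 (mem_evenPerms.mp hσ).2
    exact orbitClosure_subset_of_mem_holds hmem
      (weightedHomogeneousComponent_mem_orbitClosure hhom hm _ hmin)

end Main

end MS2001Tutte

end Literature.Computability.AlgebraicComplexity
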